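import Mathlib
import Literature.MathematicalPhysics.QuantumFieldTheory.Balaban1983to89.TreeLengthCubeSystem

/-!
# `Balaban1983to89.B13Closing` — the closing chain of §2 of T. Bałaban, *Renormalization group approach to lattice
gauge field theories. II. Cluster expansions*, Commun. Math. Phys. **116**, 1–22 (1988), doi:10.1007/bf01239022
[Balaban1988RG2Cluster] (cell paper B13; PDF held `paper:balaban1988-cmp116-rg-ii-cluster`, journal page = PDF page),
pp. 20–22 (Lemma 3 to Theorem I.3), with BOTH by-reference steps of p. 21 discharged modulo NAMED leaves and the
polymer geometry INSTANTIATED — a pure JOINER of three modules already in the tree; nothing is quoted afresh: the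
sentences of pp. 15, 20, 21 and the phrase of (2.11) p. 14 repeated in the docstrings below are quoted (and were
render-checked) in `…Balaban1983to89.B13` resp. `…Balaban1983to89.B13Resummation`.

CITATION HEADER (lean-in-tree rule 2026-08-18).  Source under audit: [Balaban1988RG2Cluster] pp. 14–15, 18, 20–22,
quoted verbatim in the docstrings of `…Balaban1983to89.B13` (unit b13: Lemma 3 p. 20, (2.38)–(2.41) and the closing
paragraph p. 21, restrictions R21–R24, the log Z^{(k)} leaf `LogHalfBound` of Part G), `…Balaban1983to89.B13Resummation`
(unit pv18: (2.11) p. 14, p. 15, (2.13) p. 14, the Kotecký–Preiss discharge `cammarotaStepWith_of_KP_R22gen` of the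
[26]-step (2.38) ⇒ (2.41)) and `…Balaban1983to89.TreeLengthCubeSystem` (unit pv22: the concrete window system `sys B`,
its `Geometry` instance `geometry B` with (1.26) p. 8, (2.27)/(2.30) p. 18 PROVED for the formalised tree length).
Published engine behind pv18's module: R. Kotecký, D. Preiss, *Cluster expansion for abstract polymer models*, Commun.
Math. Phys. **103** (1986) 491–498 — PROVED in the tree (`Literature.Probability.LatticeModels.ClusterExpansionKPBound`),
not quoted.  Cell records: GAPS.md G-B13-11 / C-pv18-3 (the [26]-step), G-B13-12 / G-adv5-5 / G-B13-12a (the log Z^{(k)}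
half: UNPRINTED estimate, typed leaf), G-B13-07 ((2.30)), C-pv22-4; SMALLNESS.md S-B13.15, S-B13.16; unit
`b2b-balaban-b13-g3`, journal claim B13-CLOSING-JOINER.  Nothing existing is modified.

WHAT THE PAPER PRINTS (p. 21 [PDF 21], quoted in `…B13`): *"The inequality (2.41) and the assumptions imply the
inequality (I.1.18), with ½E₀ instead of E₀, for the terms of the effective action E^{(k+1)} in (I.1.3)."* and *"The
expression localized in X satisfies the bound (I.1.18) with κ replaced by δ₀M, and with an absolute constant instead of
E₀. We define ½E₀ as equal to this constant, and we take M sufficiently large, so that δ₀M ≧ κ."*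

WHAT IS PROVED HERE (kernel-checked bookkeeping, zero `sorry`).  Part 1: a polymer geometry in the sense of unit pv18
(`B13Resummation.Geometry D Cube`) supplies unit b13's volume leaf `B13.VolBoundK1 D (#cubes) c₁` (`volBoundK1_of_geometry`).
Part 2 — THE GENERIC JOINER `deliverables_of_KP_logHalf`: for abstract step data `S` and ANY geometry `G` of 𝐃_{k+1},
the delivered clauses of Theorem I.3 for A_{k+1} (`B13.Deliverables S c`: (I.1.7), analyticity, (I.1.18) with E₀ and κ,
gauge invariance) follow from — and these are now ALL the hypotheses — the restrictions `S.Restr`, Lemma 3_ℓ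
(`Lemma3With`), the restriction property of the spaces (p. 15, `SpRestr`), the representation (2.13) (`Repr213`), the
UNPRINTED log Z^{(k)} leaf in its per-LM-cube form `LogHalfBound … (#cubes) B (δ₀M)` (cell GAPS G-B13-12a), (I.1.7) /
analyticity / gauge invariance of the gathered terms, and the explicit numerical conditions: `(1 − 10δ)ℓ = 1` (`R22gen`),
`O(1)C₃ε₁ ≤ ½E₀` (`R23`), `κ + 1 ≤ δ₀M` (`R24sharp`), "κ large" `κ + 2κ₀ + 2 ≤ (1 − 8δ)ℓκ`, "ε₁ small"
`C₃ε₁e^{5κ+1}K₀νc₁ ≤ 1`, `e ν c₁ K₀² ≤ A₂`, `B·c₁ ≤ ½E₀` (*"We define ½E₀ as equal to this constant"*), signs.  Neither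
`CammarotaStepWith` (the [26]-step) nor `VolBoundK1` nor a bare (I.1.18)-shaped `hlog` is a hypothesis any more
(`B13.deliverables_of_chainWith_logHalf` ∘ `B13Resummation.cammarotaStepWith_of_KP_R22gen` ∘ Part 1);
`deliverables_of_KP_logHalf_literal` is the literal reading (a) of "absolute constant" (per-site smallness θ ≤ α₀ + α₁
and R21 of p. 20, `B13.Consts.perSite_absolute_of_R21`).  Part 3 — THE CONCRETE WINDOW: `WindowStep B` is step data
whose system 𝐃_{k+1} IS unit pv22's `TreeLengthCubeSystem.sys B` (localization domains inside a finite window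
`B ⊂ ℤ^d`, d_{k+1} := `treeLen`); for it `deliverables_window` has NO geometry hypothesis at all (G := `geometry B`,
PROVED by pv22), the restriction property and (2.13) are stated in their concrete window form (`WindowStep.spRestr`,
`WindowStep.repr213`: `locE` over the incompatibility `Touch` of (2.11)), the cube count is the literal `X.card`, and the
constants are explicit: ν = 2d + 1, κ₀ = κ₀(4·2^d, 2d), K₀ = K₀(4·2^d, 2d), c₁ = 4·2^d (d = 4: κ₀ = 64 log 162, c₁ = 64,
ν = 9, K₀ = K₀(64, 8); `deliverables_window_four`).

WHAT IS *NOT* CLAIMED.  (i) The two analytic leaves are untouched: Lemma 3 (pp. 13–20, hypothesis `Lemma3With`) and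
the log Z^{(k)} estimate `LogHalfBound` (printed nowhere in the series — cell GAPS G-B13-12 stands; which reading of
"absolute" fixes its constant B is G-B13-12a, not decided here).  (ii) `SpRestr`, `Repr213`, `Repr17`, `Analytic`,
`GaugeInv`, `Restr` remain abstract predicates / hypotheses of the carrier, exactly as in the imported modules.
(iii) The window has free boundary (pv22's caveat (i): no torus wrap-around).  (iv) The printed transfer factor ℓ = L/2
of (2.36) is neither used nor proved: the chain is parametric in ℓ, closed by `(1 − 10δ)ℓ = 1` (units b13-g2 / pv11).
Value = kernel-checked bookkeeping (a join of three lineages' modules), NOT summit progress.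
-/

namespace Literature.MathematicalPhysics.QuantumFieldTheory.Balaban1983to89.B13Closing

noncomputable section

open Literature.MathematicalPhysics.QuantumFieldTheory.Balaban1983to89
open Literature.MathematicalPhysics.QuantumFieldTheory.Balaban1983to89.B13
open Literature.MathematicalPhysics.QuantumFieldTheory.Balaban1983to89.B13Resummation
open Literature.MathematicalPhysics.QuantumFieldTheory.Balaban1983to89.B13ScaleTransfer
open Literature.MathematicalPhysics.QuantumFieldTheory.Balaban1983to89.B12TreeDecay
open Literature.MathematicalPhysics.QuantumFieldTheory.Balaban1983to89.TreeLengthCubeSystem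

/-! ## Part 1. A polymer geometry supplies the volume leaf of `B13` Part G -/

/-- The additive volume bound `#cubes X ≤ c₁(1 + d_{k+1}(X))` carried by a polymer geometry (unit pv18's field
`Geometry.volBound`, the repaired (2.30) p. 18) IS unit b13's leaf `VolBoundK1` for the cube count `X ↦ #cubes X`.
[cite: Balaban1988RG2Cluster, (2.30) p.18] -/
theorem volBoundK1_of_geometry {D : LocDomainSys} {Cube : Type} [DecidableEq Cube] (G : Geometry D Cube) :
    VolBoundK1 D (fun X => (G.cubes X).card) G.c₁ :=
  fun X => G.volBound X (Finset.mem_univ X)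

/-! ## Part 2. The generic joiner: §2's closing chain with both by-reference steps discharged modulo named leaves -/

/-- **The closing chain of §2, joined.**  p. 21: *"The inequality (2.41) and the assumptions imply the inequality
(I.1.18), with ½E₀ instead of E₀"* + *"The expression localized in X satisfies the bound (I.1.18) with κ replaced by
δ₀M … We define ½E₀ as equal to this constant, and we take M sufficiently large, so that δ₀M ≧ κ."* — for abstract step
data and ANY polymer geometry of 𝐃_{k+1}: restrictions + Lemma 3_ℓ + [p. 15 restriction property + (2.13) + κ large +
ε₁ small + `e ν c₁ K₀² ≤ A₂`, replacing the [26]-step] + `(1 − 10δ)ℓ = 1` + `O(1)C₃ε₁ ≤ ½E₀` + [the per-cube log Z^{(k)}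
leaf at rate δ₀M + `B·c₁ ≤ ½E₀` + `κ + 1 ≤ δ₀M`, replacing the bare second half] + (I.1.7), analyticity, gauge
invariance ⇒ the delivered clauses for A_{k+1}.  `B13.deliverables_of_chainWith_logHalf` ∘
`B13Resummation.cammarotaStepWith_of_KP_R22gen` ∘ `volBoundK1_of_geometry`. [cite: Balaban1988RG2Cluster, pp.20–22 (Lemma 3 to Thm I.3)] -/
theorem deliverables_of_KP_logHalf (S : B13.StepData) (c : B13.Consts) {ℓ : ℝ} {Cube : Type} [DecidableEq Cube]
    (G : Geometry S.Dk1 Cube) (hsp : SpRestr S G) (hrep : Repr213 S G) (hA : 0 ≤ c.C3act * c.ε₁) (hκ : 0 ≤ c.κ)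
    (hlarge : c.κ + 2 * G.κ₀ + 2 ≤ (1 - 8 * c.δ) * ℓ * c.κ)
    (hsmall : c.C3act * c.ε₁ * Real.exp (5 * c.κ + 1) * G.K₀ * G.ν * G.c₁ ≤ 1)
    (hA₂ : Real.exp 1 * G.ν * G.c₁ * G.K₀ ^ 2 ≤ c.A₂)
    (hR : S.Restr) (h3 : Lemma3With S c ℓ) (h22 : c.R22gen ℓ) (h23 : c.R23) (h24 : c.R24sharp) (hE₀ : 0 ≤ c.E₀)
    {B : ℝ} (hB : 0 ≤ B) (hlogB : LogHalfBound S.Dk1 S.sp2 S.Elog (fun X => (G.cubes X).card) B (c.δ₀ * c.M))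
    (hE₀def : B * G.c₁ ≤ c.E₀ / 2) (hrepr : S.Repr17)
    (han : ∀ X, S.Analytic (S.Etot X) (S.sp2 X)) (hg : ∀ X, S.GaugeInv (S.Etot X)) :
    Deliverables S c :=
  deliverables_of_chainWith_logHalf S c (fun X => (G.cubes X).card) hR h3
    (cammarotaStepWith_of_KP_R22gen S c G hsp hrep h22 hA hκ hlarge hsmall hA₂) h22 h23 h24 hE₀ hB hlogB
    (volBoundK1_of_geometry G) hE₀def hrepr han hg

/-- Reading (a) of p. 21's *"with an absolute constant instead of E₀"* (cell GAPS G-B13-12a), joined: if the per-cube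
constant of the log Z^{(k)} leaf factors as `A·θ·(LM)⁴` with a per-site smallness `θ ≤ α₀ + α₁` (UNPRINTED, G-adv5-5's
repair), then under R21 of p. 20 (*"We assume that (LM)⁴α₀, (LM)⁴α₁, (LM)⁴α₄, (LM)⁴γ₂ are bounded by a constant
independent of M, for example by 1."*) the definition of ½E₀ reads
`2A·c₁ ≤ ½E₀` with `2A·c₁` independent of L, M (`B13.Consts.perSite_absolute_of_R21`). [cite: Balaban1988RG2Cluster, p.20–21 (R21, closing paragraph)] -/
theorem deliverables_of_KP_logHalf_literal (S : B13.StepData) (c : B13.Consts) {ℓ : ℝ} {Cube : Type} [DecidableEq Cube]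
    (G : Geometry S.Dk1 Cube) (hsp : SpRestr S G) (hrep : Repr213 S G) (hA : 0 ≤ c.C3act * c.ε₁) (hκ : 0 ≤ c.κ)
    (hlarge : c.κ + 2 * G.κ₀ + 2 ≤ (1 - 8 * c.δ) * ℓ * c.κ)
    (hsmall : c.C3act * c.ε₁ * Real.exp (5 * c.κ + 1) * G.K₀ * G.ν * G.c₁ ≤ 1)
    (hA₂ : Real.exp 1 * G.ν * G.c₁ * G.K₀ ^ 2 ≤ c.A₂)
    (hR : S.Restr) (h3 : Lemma3With S c ℓ) (h21 : c.R21) (h22 : c.R22gen ℓ) (h23 : c.R23) (h24 : c.R24sharp)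
    (hE₀ : 0 ≤ c.E₀) {A θ : ℝ} (hA0 : 0 ≤ A) (hθ0 : 0 ≤ θ) (hθ : θ ≤ c.α₀ + c.α₁)
    (hlog : LogHalfBound S.Dk1 S.sp2 S.Elog (fun X => (G.cubes X).card) (A * θ * ((c.L : ℝ) * c.M) ^ 4)
      (c.δ₀ * c.M))
    (hE₀def : 2 * A * G.c₁ ≤ c.E₀ / 2) (hrepr : S.Repr17)
    (han : ∀ X, S.Analytic (S.Etot X) (S.sp2 X)) (hg : ∀ X, S.GaugeInv (S.Etot X)) :
    Deliverables S c :=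
  have hB : 0 ≤ A * θ * ((c.L : ℝ) * c.M) ^ 4 := by positivity
  have hle : A * θ * ((c.L : ℝ) * c.M) ^ 4 * G.c₁ ≤ c.E₀ / 2 :=
    le_trans (mul_le_mul_of_nonneg_right (B13.Consts.perSite_absolute_of_R21 c h21 hA0 hθ) G.c₁_nonneg) hE₀def
  deliverables_of_KP_logHalf S c G hsp hrep hA hκ hlarge hsmall hA₂ hR h3 h22 h23 h24 hE₀ hB hlog hle hrepr han hg

/-! ## Part 3. The concrete window: step data over `TreeLengthCubeSystem.sys B` -/

variable {d : ℕ}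

/-- STEP DATA OVER A WINDOW: the carrier `B13.StepData` with its system of (k+1)-localization domains FIXED to be the
concrete window system of unit pv22 — 𝐃_{k+1} := the non-empty face-connected families of cubes X ⊆ B of a finite
window `B ⊂ ℤ^d`, d_{k+1} := `treeLen` ([Balaban1987RG1] p. 257 as formalised in `…TreeLengthCubeSystem.sys`).  All
other fields are those of `B13.StepData` verbatim (scale-k system, fields, bond variables, potentials, H(Z), E^{(k+1)},
the log Z^{(k)} terms, the abstract predicates). [cite: Balaban1988RG2Cluster, (1.1)–(2.13) pp.3–14 (carrier)] -/
structure WindowStep (B : Finset (Pt d)) where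
  Dk : LocDomainSys
  volk : Dk.Dom → ℕ
  Φ : Type
  Bond : Type
  [finBond : Fintype Bond]
  sp1 : Dk.Dom → Set Φ
  sp2 : (sys B).Dom → Set Φ
  Bv : Φ → Bond → ℂ
  Vp : Dk.Dom → Φ → ℂ
  V : Dk.Dom → Φ → ℂ
  Q : Dk.Dom → Φ → Bond → Bond → ℂ
  Vpp : Dk.Dom → Φ → ℂ
  H : (sys B).Dom → Φ → ℂ
  Ek1 : (sys B).Dom → Φ → ℂ
  Elog : (sys B).Dom → Φ → ℂ
  Analytic : (Φ → ℂ) → Set Φ → Prop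
  GaugeInv : (Φ → ℂ) → Prop
  Repr17 : Prop
  Restr : Prop

namespace WindowStep

variable {B : Finset (Pt d)}

/-- The window step data as abstract step data (`Dk1 := sys B`). [folklore] -/
def toStepData (W : WindowStep B) : B13.StepData where
  Dk := W.Dk
  Dk1 := sys B
  volk := W.volk
  Φ := W.Φ
  Bond := W.Bond
  finBond := W.finBond
  sp1 := W.sp1
  sp2 := W.sp2
  Bv := W.Bv
  Vp := W.Vp
  V := W.V
  Q := W.Q
  Vpp := W.Vpp
  H := W.H
  Ek1 := W.Ek1
  Elog := W.Elog
  Analytic := W.Analytic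
  GaugeInv := W.GaugeInv
  Repr17 := W.Repr17
  Restr := W.Restr

/-- The (k+1)-system of window step data is the window system, definitionally. [folklore] -/
@[simp] theorem toStepData_Dk1 (W : WindowStep B) : W.toStepData.Dk1 = sys B := rfl

/-- Hence unit pv22's CONSTRUCTED polymer geometry of the window serves window step data: no geometry hypothesis is
left. [cite: Balaban1988RG2Cluster, (2.11) p.14] -/
def geom (W : WindowStep B) : Geometry W.toStepData.Dk1 (Cell B) := geometry B

/-- The footprints of `geom` are the cells of the domain. [folklore] -/
@[simp] theorem geom_cubes (W : WindowStep B) (X : W.toStepData.Dk1.Dom) :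
    W.geom.cubes X = cellsOf B X.1 := rfl

/-- The cube count of `geom` is the literal number of cubes of the domain. [folklore] -/
theorem card_geom_cubes (W : WindowStep B) (X : W.toStepData.Dk1.Dom) :
    (W.geom.cubes X).card = X.1.card := by
  rw [geom_cubes]; exact card_cellsOf X.2.1

/-- The restriction property of the spaces (p. 15, `B13Resummation.SpRestr`) for window step data, from its form in the
printed words: a configuration in the space on X lies in the space on every domain Z ⊆ X. [cite: Balaban1988RG2Cluster, p.15] -/
theorem spRestr (W : WindowStep B) (h : ∀ X Z : (sys B).Dom, ∀ φ, Z.1 ⊆ X.1 → φ ∈ W.sp2 X → φ ∈ W.sp2 Z) :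
    SpRestr W.toStepData W.geom := by
  intro X Z φ hZX hφ
  refine h X Z φ (fun x hx => ?_) hφ
  have hxB : x ∈ B := Z.2.1 hx
  have hc : (⟨x, hxB⟩ : Cell B) ∈ cellsOf B Z.1 := mem_cellsOf.2 hx
  exact mem_cellsOf.1 (hZX hc)

open Classical in
/-- The representation (2.13) (`B13Resummation.Repr213`) for window step data, from its concrete form: E^{(k+1)}(X, φ)
is the X-localized part `locE` of log Ξ of the polymer gas on the window with the incompatibility `Touch` of (2.11) and
activities Z ↦ H(Z, φ). [cite: Balaban1988RG2Cluster, (2.13) p.14] -/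
theorem repr213 (W : WindowStep B)
    (h : ∀ X : (sys B).Dom, ∀ φ, φ ∈ W.sp2 X →
      W.Ek1 X φ = locE (Touch B) (fun Z : (sys B).Dom => cellsOf B Z.1) (fun Z => W.H Z φ) (cellsOf B X.1)) :
    Repr213 W.toStepData W.geom :=
  fun X φ hφ => h X φ hφ

end WindowStep

open WindowStep in
/-- The per-cube log Z^{(k)} leaf stated with the LITERAL cube count `#X` is the leaf for the geometry's footprint count.
[cite: Balaban1988RG2Cluster, p.21 (closing paragraph)] -/
theorem logHalfBound_geom_of_card {B : Finset (Pt d)} (W : WindowStep B) {Bc r : ℝ}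
    (h : LogHalfBound W.toStepData.Dk1 W.toStepData.sp2 W.toStepData.Elog (fun X => X.1.card) Bc r) :
    LogHalfBound W.toStepData.Dk1 W.toStepData.sp2 W.toStepData.Elog (fun X => (W.geom.cubes X).card) Bc r := by
  intro X φ hφ
  have hX := h X φ hφ
  simpa only [card_geom_cubes] using hX

open WindowStep Classical in
/-- **§2's closing chain on a concrete window of ℤ^d — no geometry hypothesis.**  For step data whose 𝐃_{k+1} is the
window system (d_{k+1} := `treeLen`), Theorem I.3's delivered clauses for A_{k+1} follow from: the restrictions, Lemma 3_ℓ,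
the restriction property of the spaces (p. 15), the representation (2.13) over the incompatibility *"Z ∩ Z′ contains a
cube, or a wall of a cube"* of (2.11), the UNPRINTED per-cube log Z^{(k)} leaf `‖Elog(X)‖ ≤ B·#X·e^{−δ₀M·treeLen X}`,
(I.1.7) / analyticity / gauge invariance, and the NUMBERS: `(1 − 10δ)ℓ = 1`, `O(1)C₃ε₁ ≤ ½E₀`, `κ + 1 ≤ δ₀M`,
`κ + 2κ₀(4·2^d, 2d) + 2 ≤ (1 − 8δ)ℓκ`, `C₃ε₁ e^{5κ+1} K₀(4·2^d, 2d) (2d + 1) 4·2^d ≤ 1`, `e (2d + 1) 4·2^d K₀(4·2^d, 2d)² ≤ A₂`,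
`B·4·2^d ≤ ½E₀`, signs — (1.26), (2.27), (2.29)/(2.30) being THEOREMS for `treeLen` (unit pv22) and the [26]-step a
THEOREM from Kotecký–Preiss (unit pv18). [cite: Balaban1988RG2Cluster, pp.20–22 (Lemma 3 to Thm I.3)] -/
theorem deliverables_window {B : Finset (Pt d)} (W : WindowStep B) (c : B13.Consts) {ℓ : ℝ}
    (hsp : ∀ X Z : (sys B).Dom, ∀ φ, Z.1 ⊆ X.1 → φ ∈ W.sp2 X → φ ∈ W.sp2 Z)
    (hrep : ∀ X : (sys B).Dom, ∀ φ, φ ∈ W.sp2 X →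
      W.Ek1 X φ = locE (Touch B) (fun Z : (sys B).Dom => cellsOf B Z.1) (fun Z => W.H Z φ) (cellsOf B X.1))
    (hA : 0 ≤ c.C3act * c.ε₁) (hκ : 0 ≤ c.κ)
    (hlarge : c.κ + 2 * kappa₀ (4 * 2 ^ d) (2 * d) + 2 ≤ (1 - 8 * c.δ) * ℓ * c.κ)
    (hsmall : c.C3act * c.ε₁ * Real.exp (5 * c.κ + 1) * K₀ (4 * 2 ^ d) (2 * d) * (2 * (d : ℝ) + 1) *
      (4 * 2 ^ d) ≤ 1)
    (hA₂ : Real.exp 1 * (2 * (d : ℝ) + 1) * (4 * 2 ^ d) * K₀ (4 * 2 ^ d) (2 * d) ^ 2 ≤ c.A₂)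
    (hR : W.toStepData.Restr) (h3 : Lemma3With W.toStepData c ℓ) (h22 : c.R22gen ℓ) (h23 : c.R23)
    (h24 : c.R24sharp) (hE₀ : 0 ≤ c.E₀) {Bc : ℝ} (hB : 0 ≤ Bc)
    (hlog : LogHalfBound W.toStepData.Dk1 W.toStepData.sp2 W.toStepData.Elog (fun X => X.1.card) Bc (c.δ₀ * c.M))
    (hE₀def : Bc * (4 * 2 ^ d) ≤ c.E₀ / 2) (hrepr : W.toStepData.Repr17)
    (han : ∀ X, W.toStepData.Analytic (W.toStepData.Etot X) (W.toStepData.sp2 X))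
    (hg : ∀ X, W.toStepData.GaugeInv (W.toStepData.Etot X)) :
    Deliverables W.toStepData c :=
  deliverables_of_KP_logHalf W.toStepData c W.geom (W.spRestr hsp) (W.repr213 hrep) hA hκ hlarge hsmall hA₂ hR h3
    h22 h23 h24 hE₀ hB (logHalfBound_geom_of_card W hlog) hE₀def hrepr han hg

open WindowStep Classical in
/-- The paper's dimension d = 4: the constants of `deliverables_window` are κ₀ = 64 log 162 (`kappa₀_four`), ν = 9,
c₁ = 64, K₀ = K₀(64, 8). [cite: Balaban1988RG2Cluster, pp.20–22 (Lemma 3 to Thm I.3)] -/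
theorem deliverables_window_four {B : Finset (Pt 4)} (W : WindowStep B) (c : B13.Consts) {ℓ : ℝ}
    (hsp : ∀ X Z : (sys B).Dom, ∀ φ, Z.1 ⊆ X.1 → φ ∈ W.sp2 X → φ ∈ W.sp2 Z)
    (hrep : ∀ X : (sys B).Dom, ∀ φ, φ ∈ W.sp2 X →
      W.Ek1 X φ = locE (Touch B) (fun Z : (sys B).Dom => cellsOf B Z.1) (fun Z => W.H Z φ) (cellsOf B X.1))
    (hA : 0 ≤ c.C3act * c.ε₁) (hκ : 0 ≤ c.κ)
    (hlarge : c.κ + 2 * (64 * Real.log 162) + 2 ≤ (1 - 8 * c.δ) * ℓ * c.κ)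
    (hsmall : c.C3act * c.ε₁ * Real.exp (5 * c.κ + 1) * K₀ 64 8 * 9 * 64 ≤ 1)
    (hA₂ : Real.exp 1 * 9 * 64 * K₀ 64 8 ^ 2 ≤ c.A₂)
    (hR : W.toStepData.Restr) (h3 : Lemma3With W.toStepData c ℓ) (h22 : c.R22gen ℓ) (h23 : c.R23)
    (h24 : c.R24sharp) (hE₀ : 0 ≤ c.E₀) {Bc : ℝ} (hB : 0 ≤ Bc)
    (hlog : LogHalfBound W.toStepData.Dk1 W.toStepData.sp2 W.toStepData.Elog (fun X => X.1.card) Bc (c.δ₀ * c.M))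
    (hE₀def : Bc * 64 ≤ c.E₀ / 2) (hrepr : W.toStepData.Repr17)
    (han : ∀ X, W.toStepData.Analytic (W.toStepData.Etot X) (W.toStepData.sp2 X))
    (hg : ∀ X, W.toStepData.GaugeInv (W.toStepData.Etot X)) :
    Deliverables W.toStepData c := by
  have hκ₀ : kappa₀ (4 * 2 ^ 4) (2 * 4) = 64 * Real.log 162 := kappa₀_four
  have h64 : (4 : ℝ) * 2 ^ 4 = 64 := by norm_num
  have h9 : 2 * ((4 : ℕ) : ℝ) + 1 = 9 := by norm_num
  have hK : K₀ (4 * 2 ^ 4) (2 * 4) = K₀ 64 8 := by norm_num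
  refine deliverables_window W c hsp hrep hA hκ ?_ ?_ ?_ hR h3 h22 h23 h24 hE₀ hB hlog ?_ hrepr han hg
  · rw [hκ₀]; exact hlarge
  · rw [hK, h9, h64]; exact hsmall
  · rw [hK, h9, h64]; exact hA₂
  · rw [h64]; exact hE₀def

end

end Literature.MathematicalPhysics.QuantumFieldTheory.Balaban1983to89.B13Closing
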